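import Summits.HodgeConjecture.CorCM.MultiFieldWeilEngine
import Summits.HodgeConjecture.CorCM.MultiFieldWeilParts
import Summits.HodgeConjecture.CorCM.SexticOcticWeilPowersHodgeOfMarkman
import HarnessLib

/-!
# COR-CM — MULTI-FIELD WEIL, part 7: the Hodge conjecture for EVERY product of copies `E^a × B_1^{n_1} × ⋯ × B_r^{n_r}`, GIVEN the defect law of
# the realised tuples and the single-slot Weil spaces (the generic headline of the multi-field Weil engine)

Cell `pub-hodgecm2` (COR-CM), seat b30 gen 28 (2026-08-23); count-neutral own lane MULTI-FIELD WEIL ENGINE; the assembly over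
`CorCM/MultiFieldWeil{FrameTransfer,Fresh,Engine,Parts}`.  Theorems only; no definition, no named fact, no `sorry`.
HONEST FRAMING: `HC_CM` is NOT proved and not asserted.  What is proved: for realisations `E = A 0 ⊨ (k; {τ})` (`[k:ℚ] = 2`, `τ(δ) = i√d`) and
`B_m = A m.succ ⊨ (K_m; Φ m.succ)` over CM fields `K_m ⊇ i_m(k)` with frames `e_m : Hom(K_m, ℂ) ≃ Fin (n m) × Bool` reading the types at
position sets `P m` (`n m = 2|P m| + c m`, `0 < |P m|`), the Hodge conjecture holds for `X = ⨁_j A(κ j)` for EVERY slot map `κ` — and for every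
abelian variety dominated by such an `X` — PROVIDED (i) `hdef`: every configuration of the model balanced under the realised tuples obeys the
DEFECT LAW (instance-specific group theory: `Census/SexticOcticDecicWeilDefect`, …), and (ii) `hW`: for each field `m` the Weil space of
`⨁_i A(partSlots (c m) m i) = B_m ⊞ E^{c m}` under the diagonal action of `δ` consists of algebraic classes (Markman-type inputs: the fourfold
theorem for `(n, c) = (3, 1)`, `(4, 0)`; the hyperbolic-sixfold theorem for `(4, 2)`, `(5, 1)`, `(6, 0)`).
PROOF.  Pohlmann–Gao–Ullmo: the Hodge classes of `X` are spanned by the weight classes of the `Aut(ℂ)`-balanced weights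
(`Pohlmann1968_thm1_cmAlgebra`); frame transfer (`modelBalancedG_of_isGaloisBalancedAlg`, no Galois hypothesis) makes each a balanced
configuration of the model; `hdef` gives its defects; the ENGINE (`weightClassesAlg_le_algebraicClasses_of_hasDefectsG`) fed with the single-slot
parts (`weightClassesAlg_le_algebraicClasses_of_partG` from `hW`) makes its line algebraic.
[cite: Pohlmann1968, Thm 1] [cite: GaoUllmo2025, Thm 3.1] [cite: Milne2020HodgeClassesAV, 1.2 (a) and Thm. 1] [cite: MoonenZarhin1995Duke, Thm. 2.4]
[cite: MumfordAV1970, §19]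

## References
* [Pohlmann1968] H. Pohlmann, Ann. of Math. 88 (1968), Thm 1.  [GaoUllmo2025] Z. Gao, E. Ullmo, J. Inst. Math. Jussieu 25 (2025), Thm 3.1.
  [Milne2020HodgeClassesAV] J. S. Milne, arXiv:2010.08857, 1.2 (a), Thm. 1.  [MoonenZarhin1995Duke] B. Moonen, Yu. Zarhin, Duke Math. J. 77
  (1995), Thm. 2.4.  [MumfordAV1970] D. Mumford, *Abelian Varieties*, §19.
-/

noncomputable section

open CategoryTheory CategoryTheory.Limits NumberField

namespace Summit.HodgeConjecture.CorCM.MultiFieldWeil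

open Literature.AlgebraicGeometry Literature.AlgebraicGeometry.Motives Literature.AlgebraicGeometry.HodgeTheory
open Literature.AlgebraicGeometry.ComplexMultiplication (IsCMTypeRealisation)
open Literature.AlgebraicGeometry.Pohlmann1968
open Literature.AlgebraicTopology.SingularHomology
open Literature.NumberTheory.ComplexMultiplication
open Summit.HodgeConjecture.CorCM.Census.MultiFieldWeil

open scoped Classical Pointwise

section Assembly

variable {I : Type} {r : ℕ} {Kf : I → Type} [∀ i, Field (Kf i)] [∀ i, NumberField (Kf i)] [∀ i, IsCMField (Kf i)]
  {i₀ : I} {is : Fin r → I} {n : Fin r → ℕ} {τ : Kf i₀ →+* ℂ}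
  {A : Fin (r + 1) → AbelianVariety ℂ} {Φ : ∀ j : Fin (r + 1), CMType (Kf (mfSlots i₀ is j))}
  {ι : ∀ j, 𝓞 (Kf (mfSlots i₀ is j)) →+* End (A j)}
  {θ : ∀ j, Kf (mfSlots i₀ is j) →+* Module.End ℂ (complexBetti (A j).X 1)}

/-- **THE MULTI-FIELD WEIL HEADLINE (frame form).  The Hodge conjecture for every product of copies `⨁_j A(κ j)` of `E, B_1, …, B_r`**, for
`E ⊨ (k; {τ})` the CM curve of the imaginary quadratic field `k = Kf i₀` (`τ(δ) = i√d`) and `B_m ⊨ (K_m; Φ m.succ)` over CM fields `K_m ⊇ i_m(k)`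
whose types are read by frames `e_m` at position sets `P m` (curve multiplicities `c m < n m`, `n m + c m = 2 w m`), GIVEN (i) the DEFECT LAW for
the configurations balanced under the realised tuples (`hdef`) and (ii) the Weil spaces of the `B_m ⊞ E^{c m}` (`hW`).  `HC_CM` is NOT asserted.
[cite: Pohlmann1968, Thm 1] [cite: GaoUllmo2025, Thm 3.1] [cite: Milne2020HodgeClassesAV, 1.2 (a) and Thm. 1] [cite: MoonenZarhin1995Duke, Thm. 2.4] -/
theorem hodgeConjectureFor_biproduct_comp_of_defectLawG
    (P : ∀ m : Fin r, Finset (Fin (n m))) (c w : Fin r → ℕ) (hw : ∀ m, n m + c m = 2 * w m) (hcn : ∀ m, c m < n m)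
    {N : ℕ} (κ : Fin N → Fin (r + 1)) (h2 : Module.finrank ℚ (Kf i₀) = 2) (im : ∀ m : Fin r, Kf i₀ →+* Kf (is m))
    {δ : 𝓞 (Kf i₀)} {d : ℕ} (hτ : τ (δ : Kf i₀) = Complex.I * (Real.sqrt d : ℂ))
    (hA : ∀ j, IsCMTypeRealisation (Φ j) (A j) (ι j) (θ j))
    (e : ∀ m : Fin r, (Kf (is m) →+* ℂ) ≃ Fin (n m) × Bool)
    (he_sign : ∀ (m : Fin r) (s : Kf (is m) →+* ℂ), (e m s).2 = true ↔ s.comp (im m) = τ)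
    (he_conj : ∀ (m : Fin r) (s : Kf (is m) →+* ℂ), e m (ComplexEmbedding.conjugate s) = ((e m s).1, !(e m s).2))
    (hΨ : ∀ σ : Kf i₀ →+* ℂ, σ ∈ (Φ 0).1 ↔ σ = τ)
    (hΦ : ∀ (m : Fin r) (s : Kf (is m) →+* ℂ), s ∈ (Φ m.succ).1 ↔ (e m s).2 = decide ((e m s).1 ∈ P m))
    (hdef : ∀ {α : Type} (v : α → PtG n) (T : Finset α), ModelBalancedG P (realisedTuples e τ) v T → ∃ t : Fin r → ℤ, HasDefectsG c v T t)
    (hW : ∀ m : Fin r, weilClassesOf (⨁ fun i => A (partSlots (c m) m i))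
      (biproduct.map fun i => ι (partSlots (c m) m i) (δfam im δ (partSlots (c m) m i))) (w m) d ≤
      algebraicClasses (⨁ fun i => A (partSlots (c m) m i)).X (w m)) :
    HodgeConjectureFor (⨁ fun j => A (κ j)).dim (⨁ fun j => A (κ j)).X := by
  have hττ : ComplexEmbedding.conjugate τ ≠ τ := QuarticCM.conjugate_ne τ
  have hk : ∀ σ : Kf i₀ →+* ℂ, σ = τ ∨ σ = ComplexEmbedding.conjugate τ := fun σ =>
    QuarticCM.eq_or_eq_conjugate_of_quadratic h2 τ σ
  -- the single-slot parts of every product of copies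
  have hpart : ∀ (m : Fin r) (s : Bool) {N' : ℕ} (κ' : Fin N' → Fin (r + 1)) (C L : Finset (Crd Kf i₀ is κ')),
      Disjoint C L → C.card = c m → (∀ x ∈ C, vG e τ κ' x = Sum.inl s) → IsLayerG (vG e τ κ') m s L →
      weightClassesAlg (fun j => A (κ' j)) (fun j => ι (κ' j)) (2 * w m) (C ∪ L) ≤ algebraicClasses (⨁ fun j => A (κ' j)).X (w m) :=
    fun m s {N'} κ' C L hCL hC hCv hL => weightClassesAlg_le_algebraicClasses_of_partG hττ hk he_sign hA hτ (c m) m (hw m) (hW m) κ' C L hCL hC hCv hL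
  refine ⟨nonempty_hodgeModel_holds (Motives.AbelianVariety.isSmoothProjective_holds (A := ⨁ fun j => A (κ j))), fun p cl hc hH => ?_⟩
  have hAκ : ∀ j, IsCMTypeRealisation (Φ (κ j)) (A (κ j)) (ι (κ j)) (θ (κ j)) := fun j => hA (κ j)
  -- every balanced configuration has an algebraic weight line: the engine
  have key : ∀ (S : Finset (Crd Kf i₀ is κ)), ModelBalancedG P (realisedTuples e τ) (vG e τ κ) S → ∀ q, S.card = 2 * q →
      weightClassesAlg (fun j => A (κ j)) (fun j => ι (κ j)) (2 * q) S ≤ algebraicClasses (⨁ fun j => A (κ j)).X q := by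
    intro S hS q hq
    obtain ⟨t, ht⟩ := hdef (vG e τ κ) S hS
    exact weightClassesAlg_le_algebraicClasses_of_hasDefectsG hττ hk he_conj hA c w hw hcn hpart κ ht hq
  have hmem : cl ∈ ⨆ S ∈ pohlmannSetsAlg (K := fun j => Kf (mfSlots i₀ is (κ j))) (fun j => Φ (κ j)) p,
      weightClassesAlg (fun j => A (κ j)) (fun j => ι (κ j)) (2 * p) S := by
    rw [← (Pohlmann1968_thm1_cmAlgebra (fun j => Kf (mfSlots i₀ is (κ j))) (fun j => A (κ j))
      (fun j => Φ (κ j)) (fun j => ι (κ j)) (fun j => θ (κ j)) hAκ p).1]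
    exact Submodule.subset_span ⟨hc, hH⟩
  have hle : (⨆ S ∈ pohlmannSetsAlg (K := fun j => Kf (mfSlots i₀ is (κ j))) (fun j => Φ (κ j)) p,
      weightClassesAlg (fun j => A (κ j)) (fun j => ι (κ j)) (2 * p) S) ≤ algebraicClasses (⨁ fun j => A (κ j)).X p := by
    refine iSup₂_le fun S hS => ?_
    exact key S (modelBalancedG_of_isGaloisBalancedAlg hττ hk he_conj hΨ hΦ κ hS.2) p hS.1
  exact hle hmem

/-- **The Hodge conjecture for every abelian variety DOMINATED by a product of copies `⨁_j A(κ j)` of `E, B_1, …, B_r`** (isogeny images,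
abelian subvarieties, quotients), under the hypotheses of `hodgeConjectureFor_biproduct_comp_of_defectLawG`.  `HC_CM` is NOT asserted.
[cite: MumfordAV1970, §19] [cite: Pohlmann1968, Thm 1] -/
theorem hodgeConjectureFor_of_avDominatedBy_comp_of_defectLawG
    (P : ∀ m : Fin r, Finset (Fin (n m))) (c w : Fin r → ℕ) (hw : ∀ m, n m + c m = 2 * w m) (hcn : ∀ m, c m < n m)
    {N : ℕ} (κ : Fin N → Fin (r + 1)) (h2 : Module.finrank ℚ (Kf i₀) = 2) (im : ∀ m : Fin r, Kf i₀ →+* Kf (is m))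
    {δ : 𝓞 (Kf i₀)} {d : ℕ} (hτ : τ (δ : Kf i₀) = Complex.I * (Real.sqrt d : ℂ))
    (hA : ∀ j, IsCMTypeRealisation (Φ j) (A j) (ι j) (θ j))
    (e : ∀ m : Fin r, (Kf (is m) →+* ℂ) ≃ Fin (n m) × Bool)
    (he_sign : ∀ (m : Fin r) (s : Kf (is m) →+* ℂ), (e m s).2 = true ↔ s.comp (im m) = τ)
    (he_conj : ∀ (m : Fin r) (s : Kf (is m) →+* ℂ), e m (ComplexEmbedding.conjugate s) = ((e m s).1, !(e m s).2))
    (hΨ : ∀ σ : Kf i₀ →+* ℂ, σ ∈ (Φ 0).1 ↔ σ = τ)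
    (hΦ : ∀ (m : Fin r) (s : Kf (is m) →+* ℂ), s ∈ (Φ m.succ).1 ↔ (e m s).2 = decide ((e m s).1 ∈ P m))
    (hdef : ∀ {α : Type} (v : α → PtG n) (T : Finset α), ModelBalancedG P (realisedTuples e τ) v T → ∃ t : Fin r → ℤ, HasDefectsG c v T t)
    (hW : ∀ m : Fin r, weilClassesOf (⨁ fun i => A (partSlots (c m) m i))
      (biproduct.map fun i => ι (partSlots (c m) m i) (δfam im δ (partSlots (c m) m i))) (w m) d ≤
      algebraicClasses (⨁ fun i => A (partSlots (c m) m i)).X (w m))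
    {X : AbelianVariety ℂ} (hX : Domination.AVDominatedBy X (⨁ fun j => A (κ j))) :
    HodgeConjectureFor X.dim X.X :=
  Domination.hodgeConjectureFor_of_avDominatedBy
    (hodgeConjectureFor_biproduct_comp_of_defectLawG P c w hw hcn κ h2 im hτ hA e he_sign he_conj hΨ hΦ hdef hW) hX

end Assembly

end Summit.HodgeConjecture.CorCM.MultiFieldWeil

end
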